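import Literature.NumberTheory.Automorphic.IntegralWeightHeckeModuleGL2
import HarnessLib

/-!
# Hecke operators of elements normalising the level: diamond-type operators

Topic `NumberTheory/Automorphic`; namespace `Literature.NumberTheory.Automorphic.LevelAction`;
definitions with bodies and theorems, continuing `IntegralWeightHeckeModuleGL2`.  The
group-theoretic half of the diamond-operator (`𝒪[T(1)/T(b)]`-module) structure of Hida theory in
the coefficients-at-`p` model ([Hida1994AIF, §2: "the action of `G`"]; [KhareThorne2017, §6.3:
"the action of `T_n(𝒪_{F,p})` by diamond operators makes `H^*(X_{U(b,c)}, ·)` a module over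
`𝒪[T(1)/T(b)]`"]): for `z ∈ Δ` NORMALISING the level `U` the double coset `U z U = z U` is a single
coset, so

* `heckeOp_apply_of_normalizing` — **`[U z U] m = z · m`** on `U`-invariants;
* `heckeOp_apply_of_mem_level` — `[U u U] = 1` for `u ∈ U`;
* `heckeOp_mul_apply_of_normalizing` — `[U z z' U] = [U z U] ∘ [U z' U]` for normalising `z, z'`;
* on cohomology: `heckeCohomology_mul_of_normalizing`, `heckeCohomology_of_mem_level`, and the
  resulting MONOID HOMOMORPHISM **`normalizingAction d : T →* End H^i(U, τ)`** for a homomorphism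
  `d : T → 𝒢` with normalising image in `Δ` (e.g. `u ↦ diag(u)_p`, the diamond operators), trivial on
  `d⁻¹(U)` (`normalizingAction_eq_one_of_mem`).

## References

* H. Hida, Ann. Inst. Fourier 44 (1994), §2 (held). [Hida1994AIF]
* C. Khare, J. A. Thorne, Amer. J. Math. 139 (2017), §6.3 (arXiv:1409.7007, held). [KhareThorne2017]
-/

noncomputable section

open CategoryTheory

namespace Literature.NumberTheory.Automorphic.LevelAction

universe u

/-! ### On invariants of an abstract `Δ`-module -/

section Abstract

variable {R : Type u} [CommRing R] {𝒢 : Type u} [Group 𝒢] {M : Type u} [AddCommGroup M]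
  [Module R M] {Δ : Submonoid 𝒢} {θ : Δ →* Module.End R M} {U : Subgroup 𝒢}

/-- For `z` normalising `U`, `U z U / U = {z U}`. [folklore] -/
theorem doubleCosetQuot_eq_singleton_of_normalizing {z : 𝒢} (hzn : ∀ u ∈ U, z⁻¹ * u * z ∈ U) :
    ArithmeticQuotient.doubleCosetQuot U z = {((z : 𝒢) : 𝒢 ⧸ U)} := by
  ext d
  simp only [Set.mem_singleton_iff]
  constructor
  · intro hd
    obtain ⟨u, hu, rfl⟩ := exists_mk_eq_of_mem_doubleCosetQuot hd
    rw [QuotientGroup.eq, mul_inv_rev]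
    exact hzn _ (U.inv_mem hu)
  · rintro rfl
    exact MulAction.mem_orbit_self _

/-- **`[U z U] m = z · m` on `M^U` for `z ∈ Δ` normalising `U`.** [cite: Hida1994AIF, §2] -/
theorem heckeOp_apply_of_normalizing (hU : U.toSubmonoid ≤ Δ) {z : 𝒢} (hz : z ∈ Δ)
    (hzn : ∀ u ∈ U, z⁻¹ * u * z ∈ U) {m : M} (hm : m ∈ invariants Δ θ U) :
    heckeOp Δ θ U z m = act Δ θ z m := by
  have hset := doubleCosetQuot_eq_singleton_of_normalizing (U := U) hzn
  have hfin : (ArithmeticQuotient.doubleCosetQuot U z).Finite := by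
    rw [hset]
    exact Set.finite_singleton _
  rw [heckeOp_apply_eq_sum_of_rep hU hfin hm (fun _ => z) (fun _ _ => hz)
    (fun d hd => by rw [hset] at hd; exact hd.symm)]
  have : hfin.toFinset = {((z : 𝒢) : 𝒢 ⧸ U)} :=
    Finset.ext fun d => by rw [Set.Finite.mem_toFinset, hset]; simp
  rw [this, Finset.sum_singleton]

/-- `[U u U] m = m` on `M^U` for `u ∈ U`. [folklore] -/
theorem heckeOp_apply_of_mem_level (hU : U.toSubmonoid ≤ Δ) {u : 𝒢} (hu : u ∈ U) {m : M}
    (hm : m ∈ invariants Δ θ U) : heckeOp Δ θ U u m = m := by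
  rw [heckeOp_apply_of_normalizing hU (hU hu) (fun u' hu' => U.mul_mem (U.mul_mem (U.inv_mem hu) hu') hu) hm]
  exact hm u hu

/-- A product of normalising elements normalises. [folklore] -/
theorem normalizing_mul {z z' : 𝒢} (hzn : ∀ u ∈ U, z⁻¹ * u * z ∈ U) (hzn' : ∀ u ∈ U, z'⁻¹ * u * z' ∈ U)
    (u : 𝒢) (hu : u ∈ U) : (z * z')⁻¹ * u * (z * z') ∈ U := by
  have h := hzn' _ (hzn u hu)
  rwa [mul_inv_rev, show z'⁻¹ * z⁻¹ * u * (z * z') = z'⁻¹ * (z⁻¹ * u * z) * z' by simp only [mul_assoc]]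

/-- **`[U z z' U] = [U z U] ∘ [U z' U]` on `M^U` for normalising `z, z' ∈ Δ`.** [cite: Hida1994AIF, §2] -/
theorem heckeOp_mul_apply_of_normalizing (hU : U.toSubmonoid ≤ Δ) {z z' : 𝒢} (hz : z ∈ Δ) (hz' : z' ∈ Δ)
    (hzn : ∀ u ∈ U, z⁻¹ * u * z ∈ U) (hzn' : ∀ u ∈ U, z'⁻¹ * u * z' ∈ U) {m : M}
    (hm : m ∈ invariants Δ θ U) :
    heckeOp Δ θ U (z * z') m = heckeOp Δ θ U z (heckeOp Δ θ U z' m) := by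
  rw [heckeOp_apply_of_normalizing hU (Δ.mul_mem hz hz') (normalizing_mul hzn hzn') hm,
    heckeOp_apply_of_normalizing hU hz' hzn' hm, act_mul hz hz', Module.End.mul_apply]
  have hm' : act Δ θ z' m ∈ invariants Δ θ U := by
    rw [← heckeOp_apply_of_normalizing hU hz' hzn' hm]
    exact heckeOp_apply_mem hU hz' hm
  rw [heckeOp_apply_of_normalizing hU hz hzn hm']

end Abstract

/-! ### On the cohomology `H^i(U, τ)` -/

section Cohomology

variable {R : Type u} [CommRing R] {Γ 𝒢 : Type u} [Group Γ] [Group 𝒢] (ι : Γ →* 𝒢) (Δ : Submonoid 𝒢)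
  {V : Type u} [AddCommGroup V] [Module R V] (τ : Δ →* Module.End R V) (U : Subgroup 𝒢)
  (hU : U.toSubmonoid ≤ Δ)

/-- `heckeRepHom` of a product of normalising elements. [folklore] -/
theorem heckeRepHom_mul_of_normalizing {z z' : 𝒢} (hz : z ∈ Δ) (hz' : z' ∈ Δ)
    (hzn : ∀ u ∈ U, z⁻¹ * u * z ∈ U) (hzn' : ∀ u ∈ U, z'⁻¹ * u * z' ∈ U) :
    heckeRepHom ι Δ τ U hU (Δ.mul_mem hz hz') = heckeRepHom ι Δ τ U hU hz' ≫ heckeRepHom ι Δ τ U hU hz :=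
  Rep.hom_ext (Representation.IntertwiningMap.ext (LinearMap.ext fun f =>
    Subtype.ext (heckeOp_mul_apply_of_normalizing hU hz hz' hzn hzn' f.2)))

/-- `heckeRepHom` of an element of the level is the identity. [folklore] -/
theorem heckeRepHom_of_mem_level {u : 𝒢} (hu : u ∈ U) :
    heckeRepHom ι Δ τ U hU (hU hu) = 𝟙 _ :=
  Rep.hom_ext (Representation.IntertwiningMap.ext (LinearMap.ext fun f =>
    Subtype.ext (heckeOp_apply_of_mem_level hU hu f.2)))

/-- **`[U z z' U] = [U z U] ∘ [U z' U]` on `H^i(U, τ)`** for normalising `z, z' ∈ Δ`. [cite: Hida1994AIF, §2] -/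
theorem heckeCohomology_mul_of_normalizing {z z' : 𝒢} (hz : z ∈ Δ) (hz' : z' ∈ Δ)
    (hzn : ∀ u ∈ U, z⁻¹ * u * z ∈ U) (hzn' : ∀ u ∈ U, z'⁻¹ * u * z' ∈ U) (i : ℕ) :
    heckeCohomology ι Δ τ U hU (Δ.mul_mem hz hz') i =
      heckeCohomology ι Δ τ U hU hz i * heckeCohomology ι Δ τ U hU hz' i := by
  dsimp only [heckeCohomology]
  rw [heckeRepHom_mul_of_normalizing ι Δ τ U hU hz hz' hzn hzn', groupCohomology.map_id_comp,
    ModuleCat.hom_comp, Module.End.mul_eq_comp]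

/-- **`[U u U] = 1` on `H^i(U, τ)` for `u ∈ U`.** [folklore] -/
theorem heckeCohomology_of_mem_level {u : 𝒢} (hu : u ∈ U) (i : ℕ) :
    heckeCohomology ι Δ τ U hU (hU hu) i = 1 := by
  dsimp only [heckeCohomology]
  rw [heckeRepHom_of_mem_level ι Δ τ U hU hu, groupCohomology.map_id]
  rfl

variable {T : Type u} [Group T] (d : T →* 𝒢) (hdΔ : ∀ t, d t ∈ Δ) (hdn : ∀ (t : T) (u : 𝒢), u ∈ U → (d t)⁻¹ * u * d t ∈ U)

/-- **The action of a group `T` on `H^i(U, τ)` through Hecke operators of normalising elements**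
(`t ↦ [U d(t) U]`, a monoid homomorphism; e.g. the diamond operators `u ↦ ⟨u⟩ = [U diag(u)_p U]` of
the torus `T = T_n(𝒪_{F,p})`). [cite: Hida1994AIF, §2] [cite: KhareThorne2017, §6.3] -/
def normalizingAction (i : ℕ) : T →* Module.End R (cohomology ι Δ τ U i) where
  toFun t := heckeCohomology ι Δ τ U hU (hdΔ t) i
  map_one' := by
    have h1 : d 1 ∈ U := by rw [map_one]; exact U.one_mem
    exact heckeCohomology_of_mem_level ι Δ τ U hU h1 i
  map_mul' t t' := by
    have h := heckeCohomology_mul_of_normalizing ι Δ τ U hU (hdΔ t) (hdΔ t') (hdn t) (hdn t') i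
    have hmul : d (t * t') = d t * d t' := map_mul d t t'
    -- transport along `d (t t') = d t * d t'` (proof-irrelevant membership)
    have : heckeCohomology ι Δ τ U hU (hdΔ (t * t')) i = heckeCohomology ι Δ τ U hU (Δ.mul_mem (hdΔ t) (hdΔ t')) i := by
      congr 1
    rw [this, h]

/-- Unfolding `normalizingAction`. [folklore] -/
@[simp]
theorem normalizingAction_apply (i : ℕ) (t : T) :
    normalizingAction ι Δ τ U hU d hdΔ hdn i t = heckeCohomology ι Δ τ U hU (hdΔ t) i :=
  rfl

/-- **The action is trivial on `d⁻¹(U)`** (e.g. the diamond operators of `T(b)` on level `U(b,c)`),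
so it factors through `T / d⁻¹(U)`. [cite: KhareThorne2017, §6.3] -/
theorem normalizingAction_eq_one_of_mem (i : ℕ) {t : T} (ht : d t ∈ U) :
    normalizingAction ι Δ τ U hU d hdΔ hdn i t = 1 :=
  heckeCohomology_of_mem_level ι Δ τ U hU ht i

/-- `d⁻¹(U) ≤ ker`. [folklore] -/
theorem comap_le_ker_normalizingAction (i : ℕ) :
    U.comap d ≤ (normalizingAction ι Δ τ U hU d hdΔ hdn i).ker := fun _ ht =>
  normalizingAction_eq_one_of_mem ι Δ τ U hU d hdΔ hdn i ht

end Cohomology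

end Literature.NumberTheory.Automorphic.LevelAction
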